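import Summits.ResolutionOfSingularities.ResolutionOfSingularities.Theorems.RadicialJungCleanModelsCor217Transport
import Summits.ResolutionOfSingularities.ResolutionOfSingularities.Theorems.RadicialJungCleanModelsWeakEmbeddedLUResidueSide
import Summits.ResolutionOfSingularities.ResolutionOfSingularities.Theorems.RadicialJungCleanModelsNSResidueLocAtCentre
import HarnessLib

/-!
# Plain regularisation of the residue ring KEEPING the local ring at the centre of `ν₁` (step (S3) of the rank-one reduction of `hMono_4`)

Route `RadicialJung`, crux `CleanModels` (stmt-ResolutionOfSingularities-15917), registered skeleton `Cruxes/CleanModels/Lines/Sketch.lean`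
rev 35 (sha16 de44649d8f729c3b), stub 7 `stub_cleanModelsDimGEFour`.  Explicit-unit seat `decomp-res-hand-2` g5 (structural hand); memo
`Cruxes/CleanModels/Lines/Sketch-memo-hand2-g5-stubs-5-7.md` §3 (S3).  OURS; structural bookkeeping, counted 0; nothing here proves resolution of
singularities in characteristic `p`.

The tree's ✓ `novacoskiSpivakovsky2014_cor217` (NS Cor. 2.17) regularises the residue ring `A_𝔮 / 𝔭` but does not STATE that the local ring at
the centre of `ν₁` is unchanged; g4's ✓ `cor217_transport` states it (α) for an arbitrary residue-side property.  This file specialises the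
latter to «the residue-side local ring is regular», fed by ✓ `weakEmbeddedLU_residueSide_dimLEFour` with `W = ∅` (F-02 + F-32, transcendence
degree `≤ 4`, `O₁ ≠ K`), and converts the residue correspondence into the regularity of `A'_𝔮' / 𝔭'`:

* `range_centreResidueLift_eq_range_residue_locAtCentre` — the image `θ.range ⊆ κ(O₁)` of `A_𝔮` (tree `centreResidueLift`) is the ring of
  residues of `locAtCentre A O`;
* `exists_model_residue_regular_locAtCentre_eq` — **(S3)**: a finitely generated `A ⊆ A' ⊆ O` with `locAtCentre A' O₁ = locAtCentre A O₁` and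
  `A'_𝔮' / 𝔭'` regular.
[cite: NovacoskiSpivakovsky2014, Cor. 2.17 and §3.2] [cite: CossartPiltant2019, Thm. 1.1] [cite: CossartJannsenSaito2020, Cor. 1.5]
-/

noncomputable section

set_option linter.dupNamespace false -- mandated namespace of this single-conjunct summit

open IsLocalRing AlgebraicGeometry CategoryTheory
open Literature.AlgebraicGeometry.Resolution Literature.AlgebraicGeometry.Motives

namespace Summit.ResolutionOfSingularities.ResolutionOfSingularities.Theorems.RadicialJung.CleanModels

variable {k K : Type} [Field k] [Field K] [Algebra k K]

/-- The image of `A_𝔮` in `κ(O₁)` under a residue lift `θ` is the ring of residues of `locAtCentre A O`. [folklore] -/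
theorem range_centreResidueLift_eq_range_residue_locAtCentre (O O₁ : ValuationSubring K) (hO : O ≤ O₁)
    (A : Subalgebra k K) (hA : A.toSubring ≤ O.toSubring) [IsFractionRing A.toSubring K]
    (θ : Localization.AtPrime ((maximalIdeal O).comap (Subring.inclusion hA)) →+* ResidueField O₁)
    (hθ : ∀ a : A.toSubring, θ (algebraMap A.toSubring _ a) = ((residue O₁).comp (Subring.inclusion (hA.trans hO))) a) :
    θ.range = ((residue O₁).comp (Subring.inclusion ((locAtCentre_le hA).trans hO))).range := by
  have hAO₁ : A.toSubring ≤ O₁.toSubring := hA.trans hO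
  ext y
  rw [mem_range_centreResidueLift_iff O O₁ hO A hA θ hθ]
  constructor
  · rintro ⟨a, s, hs, rfl⟩
    have hs1 : O.valuation (s : K) = 1 := (mem_primeCompl_centre_iff O A hA s).mp hs
    have hs1' : O₁.valuation (s : K) = 1 := by
      have hsO : (s : K) ∈ O := hA s.2
      have hinvO : (s : K)⁻¹ ∈ O := (O.valuation_le_one_iff _).mp (by rw [map_inv₀, hs1, inv_one])
      apply le_antisymm ((O₁.valuation_le_one_iff _).mpr (hO hsO))
      have h2 : O₁.valuation (s : K)⁻¹ ≤ 1 := (O₁.valuation_le_one_iff _).mpr (hO hinvO)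
      rw [map_inv₀] at h2
      exact (inv_le_one₀ (by rw [Valuation.pos_iff]; exact ne_zero_of_valuation_eq_one hs1)).mp h2
    have hmem : (a : K) / (s : K) ∈ locAtCentre A.toSubring O := (mem_locAtCentre_iff).mpr ⟨a, a.2, s, s.2, hs1, rfl⟩
    refine ⟨⟨(a : K) / (s : K), hmem⟩, ?_⟩
    change residue O₁ ⟨(a : K) / (s : K), _⟩ = residue O₁ ⟨(a : K), _⟩ / residue O₁ ⟨(s : K), _⟩
    exact residue_div O₁ (a : K) (s : K) (hAO₁ a.2) (hAO₁ s.2) hs1' _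
  · rintro ⟨f, rfl⟩
    obtain ⟨a, ha, s, hs, hs1, hf⟩ := (mem_locAtCentre_iff).mp f.2
    have hsQ : (⟨s, hs⟩ : A.toSubring) ∉ ((maximalIdeal O).comap (Subring.inclusion hA)) :=
      (mem_primeCompl_centre_iff O A hA ⟨s, hs⟩).mpr hs1
    have hs1' : O₁.valuation s = 1 := by
      have hsO : s ∈ O := hA hs
      have hinvO : s⁻¹ ∈ O := (O.valuation_le_one_iff _).mp (by rw [map_inv₀, hs1, inv_one])
      apply le_antisymm ((O₁.valuation_le_one_iff _).mpr (hO hsO))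
      have h2 : O₁.valuation s⁻¹ ≤ 1 := (O₁.valuation_le_one_iff _).mpr (hO hinvO)
      rw [map_inv₀] at h2
      exact (inv_le_one₀ (by rw [Valuation.pos_iff]; exact ne_zero_of_valuation_eq_one hs1)).mp h2
    refine ⟨⟨a, ha⟩, ⟨s, hs⟩, hsQ, ?_⟩
    have hfO₁ : a / s ∈ O₁ := hf ▸ hO (locAtCentre_le hA f.2)
    change residue O₁ ⟨(f : K), _⟩ = residue O₁ ⟨a, _⟩ / residue O₁ ⟨s, _⟩
    have : (⟨(f : K), hO (locAtCentre_le hA f.2)⟩ : O₁) = ⟨a / s, hfO₁⟩ := Subtype.ext hf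
    rw [this]
    exact residue_div O₁ a s (hAO₁ ha) (hAO₁ hs) hs1' hfO₁

/-- **(S3) Plain regularisation of the residue ring, keeping the local ring at the centre of `ν₁`** (F-02 + F-32, transcendence degree `≤ 4`):
for `O < O₁ < K` and a finitely generated model `A ⊆ O` with `dim A ≤ 4`, there is a finitely generated `A ⊆ A' ⊆ O` with
`locAtCentre A' O₁ = locAtCentre A O₁` and `A'_𝔮' / 𝔭'` regular.
[cite: NovacoskiSpivakovsky2014, Cor. 2.17] [cite: CossartPiltant2019, Thm. 1.1] [cite: CossartJannsenSaito2020, Cor. 1.5] -/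
theorem exists_model_residue_regular_locAtCentre_eq (hCP : CossartPiltant2019.{0})
    (hEmb : ∀ (Z : Scheme.{0}) [IsIntegral Z] [IsNoetherian Z], Scheme.IsRegular Z →
      Scheme.IsExcellent Z → ∀ (X : Set Z), IsClosed X → X ≠ Set.univ → topologicalKrullDim X ≤ 2 →
        ∃ (Z' : Scheme.{0}) (π : Z' ⟶ Z), IsProper π ∧ Function.Surjective π.base ∧
          (∃ U : Z.Opens, (U : Set Z) = Xᶜ ∧ IsIso (π ∣_ U)) ∧
          IsStrictNormalCrossingsDivisor Z' (π.base ⁻¹' X))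
    (O O₁ : ValuationSubring K) (hO : O ≤ O₁) (hO₁ : O₁ ≠ ⊤)
    (A : Subalgebra k K) (hA : A.toSubring ≤ O.toSubring) (hAfg : A.FG) (hfrac : IsFractionRing A K)
    (hdimA : ringKrullDim A ≤ 4) :
    ∃ (A' : Subalgebra k K) (hA' : A'.toSubring ≤ O.toSubring), A ≤ A' ∧ A'.FG ∧
      locAtCentre A'.toSubring O₁ = locAtCentre A.toSubring O₁ ∧
      IsRegularLocalRing
        (Localization.AtPrime ((maximalIdeal O).comap (Subring.inclusion hA')) ⧸
          ((maximalIdeal O₁).comap (Subring.inclusion (hA'.trans hO))).map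
            (algebraMap A'.toSubring (Localization.AtPrime ((maximalIdeal O).comap (Subring.inclusion hA'))))) := by
  classical
  haveI := hfrac
  obtain ⟨A', hA', hAA', hA'fg, hα, κ, _, _, ι, φ, B, hB, hφ, hφB, hregB, hcl1, hcl2⟩ :=
    cor217_transport O O₁ hO A hA hAfg
      (fun κ _ _ ι B => IsRegularLocalRing (locAtCentre B.toSubring ((residueValuationSubring O O₁ hO).comap ι)))
      (fun κ _ _ ι φ hφ hfr => by
        haveI := hfr
        obtain ⟨B, hB, hφB, hBfg, hreg, -⟩ :=
          weakEmbeddedLU_residueSide_dimLEFour hCP hEmb O O₁ hO hO₁ A hA hAfg hdimA κ ι φ hφ hfr ∅ (by simp)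
        exact ⟨B, hB, hφB, hBfg, hreg⟩)
  refine ⟨A', hA', hAA', hA'fg, hα, ?_⟩
  haveI hfrac' : IsFractionRing A'.toSubring K := isFractionRing_subalgebra_of_le A A' hAA'
  -- the residue ring of `A'` is `ι (locAtCentre B Ō')`
  set Ō' := (residueValuationSubring O O₁ hO).comap ι with hŌ'def
  set LB := locAtCentre B.toSubring Ō' with hLBdef
  obtain ⟨θ', hθ'⟩ := exists_centreResidueLift O O₁ hO A' hA'
  obtain ⟨e₁⟩ := nonempty_quotCentre_ringEquiv_range O O₁ hO A' hA' θ' hθ'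
  have hrange : θ'.range = LB.map ι := by
    rw [range_centreResidueLift_eq_range_residue_locAtCentre O O₁ hO A' hA' θ' hθ']
    ext y
    constructor
    · rintro ⟨x, rfl⟩
      obtain ⟨b, hb, hxb⟩ := hcl1 (x : K) x.2
      exact Subring.mem_map.mpr ⟨b, hb, hxb.symm⟩
    · intro hy
      obtain ⟨b, hbmem, rfl⟩ := Subring.mem_map.mp hy
      obtain ⟨x, hx, hxb⟩ := hcl2 b hbmem
      exact ⟨⟨x, hx⟩, hxb⟩
  have e₂ : LB ≃+* LB.map ι := Subring.equivMapOfInjective LB ι ι.injective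
  haveI : IsRegularLocalRing LB := hregB
  exact IsRegularLocalRing.of_ringEquiv (e₂.trans ((RingEquiv.subringCongr hrange.symm).trans e₁.symm))

end Summit.ResolutionOfSingularities.ResolutionOfSingularities.Theorems.RadicialJung.CleanModels

end
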